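import Literature.Algebra.EuclideanLattices.SmoothingParameterProofs
import HarnessLib

/-!
# MR07 Lemma 3.2 (`η_{2⁻ⁿ}(L) ≤ √n/λ₁(L*)`) and the mass estimate above the smoothing parameter — discharges

Topic `Algebra/EuclideanLattices` (family `pqc`), sequel of `SmoothingParameterProofs.lean`; serves the
decomposition of Micciancio–Regev 2007, Thm. 5.23
(`Literature.Computability.Cryptography.MicciancioRegev2007_gapCVP'_to_SIS'`): eq. (15) of its proof
(authors' version p. 29) is Lemma 3.2, and Lemmas 4.1–4.4 / Cor. 4.6 used in eqs. (16)–(20) all rest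
on the Poisson-summation mass estimate `ρ_{s,c}(L) ∈ [1 - ε, 1 + ε] · sⁿ/vol(L)` for `s ≥ η_ε(L)`.
Everything here is PROVED; theorems only.

## Results

* `smoothingParameter_two_pow_neg_le_holds` — DISCHARGE of `smoothingParameter_two_pow_neg_le`
  (`PQCDiscreteGaussian.lean`): **Micciancio–Regev 2007, Lemma 3.2** in the ℓ² form (Regev 2009,
  Lemma 2.6), `η_ε(L) ≤ √n/λ₁(L*)` for `ε = 2⁻ⁿ`. Proof as printed (p. 11): for `s > √n/λ₁(L*)` every
  nonzero dual vector lies outside the ball of radius `√n/s`, so Banaszczyk's tail bound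
  (`gaussianMass_diff_ball_le_pow_mul_holds`, constant `C = √(2πe) e^{-π} ≤ 1/4`) gives
  `ρ_{1/s}(L* ∖ {0}) ≤ Cⁿ ρ_{1/s}(L*) = Cⁿ (1 + ρ_{1/s}(L* ∖ {0}))`, whence
  `ρ_{1/s}(L* ∖ {0}) ≤ Cⁿ/(1 - Cⁿ) ≤ 4⁻ⁿ/(1 - 4⁻ⁿ) ≤ 2⁻ⁿ` (`n ≥ 1`; the zero space is trivial).
* `abs_gaussianMass_div_sub_one_le_holds` — DISCHARGE of `abs_gaussianMass_div_sub_one_le`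
  (`PQCDiscreteGaussian.lean`): **Regev 2009, Claim 3.8** = the computation in the proof of
  **Micciancio–Regev 2007, Lemma 4.1 / Lemma 4.4** (p. 13, p. 15: "`ρ_{s,c}(Λ) = det(Λ*) sⁿ ∑_{w ∈ Λ*}
  e^{2πi⟨c,w⟩} ρ_{1/s}(w)`" and `|∑_{w ≠ 0}| ≤ ρ_{1/s}(Λ* ∖ {0}) ≤ ε`): for `0 < ε`, `0 < s`,
  `η_ε(L) ≤ s` and every centre `c`, `|ρ_{s,c}(L) / (sⁿ/vol(L)) - 1| ≤ ε`. Proof: the shifted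
  Poisson identity (`tsum_gaussianFunction_sub_eq`, `GaussianLatticeSums.lean`), splitting off the
  term `w = 0`, `|cos| ≤ 1`, and `ρ_{1/s}(L* ∖ {0}) ≤ ε` for `s ≥ η_ε`
  (`gaussianMass_dual_le_of_smoothingParameter_le`).

## References

* D. Micciancio, O. Regev, *Worst-case to average-case reductions based on Gaussian measures*,
  SIAM J. Comput. 37 (2007) 267–302, Lemma 3.2 (p. 10–11), Lemma 4.1 (p. 13), Lemma 4.4 (p. 15) of
  the authors' version.
* O. Regev, *On lattices, learning with errors, random linear codes, and cryptography*, J. ACM 56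
  (2009), Lemma 2.6, Claim 3.8.
* W. Banaszczyk, *New bounds in some transference theorems in the geometry of numbers*,
  Math. Ann. 296 (1993), Lemma 1.5.
-/

noncomputable section

open MeasureTheory Module Metric Filter
open scoped Real ENNReal InnerProductSpace Topology

namespace Literature.Algebra.EuclideanLattices

section General

variable {E : Type*} [NormedAddCommGroup E]

/-- `λ₁(Λ) ≤ ‖w‖` for every nonzero `w ∈ Λ` (the infimum is a lower bound; any normed group).
[folklore] -/
theorem minNorm_le_norm_of_mem_of_ne_zero (Λ : Submodule ℤ E) {w : E} (hw : w ∈ Λ) (hw0 : w ≠ 0) :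
    minNorm Λ ≤ ‖w‖ :=
  csInf_le ⟨0, by rintro _ ⟨x, -, rfl⟩; exact norm_nonneg x⟩ ⟨w, ⟨hw, hw0⟩, rfl⟩

/-- The numerical constant of Micciancio–Regev 2007, Lemma 3.2: `C = √(2πe) e^{-π} < 1/4` (p. 11,
"`C = √(2πe) · e^{-π} < 1/4`"); here `≤ 4⁻¹` from `√(2πe) ≤ 5` and `e^{-π} ≤ 1/20`.
[cite: MicciancioRegev2007, Lemma 3.2 (proof, p. 11)] -/
theorem sqrt_two_pi_e_mul_exp_neg_pi_le_quarter : Real.sqrt (2 * π * Real.exp 1) * Real.exp (-π) ≤ 4⁻¹ := by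
  have hπ := Real.pi_lt_d2
  have hπ' := Real.pi_gt_d2
  have he := Real.exp_one_lt_d9
  have he' := Real.exp_one_gt_d9
  have h1 : Real.sqrt (2 * π * Real.exp 1) ≤ 5 := by
    rw [Real.sqrt_le_left (by norm_num)]
    nlinarith
  have h2 : Real.exp (-π) ≤ 1 / 20 := by
    rw [Real.exp_neg, inv_eq_one_div, div_le_div_iff_of_pos_left one_pos (Real.exp_pos _) (by norm_num)]
    have h3 : Real.exp 3 ≤ Real.exp π := Real.exp_le_exp.2 (by linarith)
    have h4 : (20 : ℝ) ≤ Real.exp 3 := by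
      rw [show (3 : ℝ) = 1 + 1 + 1 by norm_num, Real.exp_add, Real.exp_add]
      nlinarith [Real.exp_pos 1]
    linarith
  calc Real.sqrt (2 * π * Real.exp 1) * Real.exp (-π) ≤ 5 * (1 / 20) := by gcongr
    _ = 4⁻¹ := by norm_num

end General

section FullRank

variable {E : Type*} [NormedAddCommGroup E] [InnerProductSpace ℝ E] (L : Submodule ℤ E)
  [FiniteDimensional ℝ E] [DiscreteTopology L] [IsZLattice ℝ L]

/-- The dual of a full-rank lattice in a nontrivial space is nonzero. [folklore] -/
theorem dualLattice_ne_bot [Nontrivial E] : dualLattice L ≠ ⊥ := by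
  intro h
  have htop : Submodule.span ℝ ((dualLattice L : Submodule ℤ E) : Set E) = ⊤ := IsZLattice.span_top
  rw [h, Submodule.bot_coe, Submodule.span_zero_singleton] at htop
  exact bot_ne_top htop

/-- **Micciancio–Regev 2007, Lemma 3.2, main estimate**: in dimension `n ≥ 1`, for every
`s > √n/λ₁(L*)`, `ρ_{1/s}(L* ∖ {0}) ≤ 2⁻ⁿ` (Banaszczyk's tail bound with `C = √(2πe)e^{-π} ≤ 1/4`:
`ρ_{1/s}(L* ∖ {0}) ≤ Cⁿ(1 + ρ_{1/s}(L* ∖ {0}))`, and `4⁻ⁿ/(1 - 4⁻ⁿ) ≤ 2⁻ⁿ`).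
[cite: MicciancioRegev2007, Lemma 3.2 (proof, p. 11)] -/
theorem gaussianMass_dual_le_two_pow_neg_of_lt [Nontrivial E] {s : ℝ}
    (hs : Real.sqrt (finrank ℝ E) / minNorm (dualLattice L) < s) :
    gaussianMass (1 / s) 0 ((dualLattice L : Set E) \ {0}) ≤ ENNReal.ofReal ((2⁻¹ : ℝ) ^ finrank ℝ E) := by
  set n : ℕ := finrank ℝ E with hn
  have hn0 : n ≠ 0 := (Module.finrank_pos (R := ℝ) (M := E)).ne'
  set Λ : Submodule ℤ E := dualLattice L with hΛ
  have hlam : 0 < minNorm Λ := minNorm_pos_of_ne_bot Λ (dualLattice_ne_bot L)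
  have hsqrt : 0 < Real.sqrt n := Real.sqrt_pos.2 (by exact_mod_cast Nat.pos_of_ne_zero hn0)
  have hs0 : 0 < s := lt_trans (div_pos hsqrt hlam) hs
  set σ : ℝ := 1 / s with hσdef
  have hσ : 0 < σ := one_div_pos.2 hs0
  have hσn : σ * Real.sqrt n < minNorm Λ := by
    rw [hσdef, one_div_mul_eq_div, div_lt_iff₀ hs0]
    rw [div_lt_iff₀ hlam] at hs
    linarith
  -- every nonzero dual vector lies outside the ball of radius `σ √n`
  have hsub : (Λ : Set E) \ {0} ⊆ (Λ : Set E) \ ball (0 : E) (1 * σ * Real.sqrt n) := by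
    rintro w ⟨hw, hw0⟩
    refine ⟨hw, ?_⟩
    rw [Metric.mem_ball, dist_zero_right, not_lt, one_mul]
    exact hσn.le.trans (minNorm_le_norm_of_mem_of_ne_zero Λ hw hw0)
  have h1 : 1 / Real.sqrt (2 * Real.pi) ≤ 1 := by
    rw [div_le_one (Real.sqrt_pos.2 (by positivity))]
    exact Real.one_le_sqrt.2 (by linarith [Real.pi_gt_three])
  have hB := gaussianMass_diff_ball_le_pow_mul_holds Λ hσ h1
  set K : ℝ := (1 * Real.sqrt (2 * Real.pi * Real.exp 1) * Real.exp (-Real.pi * 1 ^ 2)) ^ n with hK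
  set m : ℝ≥0∞ := gaussianMass σ 0 ((Λ : Set E) \ {0}) with hm
  have hmtop : m ≠ ∞ :=
    ne_top_of_le_ne_top (gaussianMass_lattice_ne_top Λ hσ.ne' 0) (gaussianMass_mono _ _ Set.sdiff_subset)
  -- `m ≤ K (1 + m)` in `ℝ≥0∞`
  have hmle : m ≤ ENNReal.ofReal K * (1 + m) := by
    calc m ≤ gaussianMass σ 0 ((Λ : Set E) \ ball (0 : E) (1 * σ * Real.sqrt n)) := gaussianMass_mono _ _ hsub
      _ ≤ ENNReal.ofReal K * gaussianMass σ 0 (Λ : Set E) := hB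
      _ = ENNReal.ofReal K * (1 + m) := by
          rw [gaussianMass_eq_add_sdiff_zero Λ σ 0, gaussianFunction_zero, ENNReal.ofReal_one]
  -- the same in `ℝ`
  set x : ℝ := (2⁻¹ : ℝ) ^ n with hx
  have hx0 : 0 < x := by positivity
  have hx2 : x ≤ 2⁻¹ := pow_le_of_le_one (by norm_num) (by norm_num) hn0
  have hK0 : 0 ≤ K := by positivity
  have hKx : K ≤ x ^ 2 := by
    have hC : 1 * Real.sqrt (2 * Real.pi * Real.exp 1) * Real.exp (-Real.pi * 1 ^ 2) ≤ (2⁻¹ : ℝ) ^ 2 := by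
      rw [one_mul, one_pow, mul_one]
      exact sqrt_two_pi_e_mul_exp_neg_pi_le_quarter.trans (by norm_num)
    calc K ≤ ((2⁻¹ : ℝ) ^ 2) ^ n := pow_le_pow_left₀ (by positivity) hC n
      _ = x ^ 2 := by rw [hx, ← pow_mul, ← pow_mul, mul_comm]
  have hreal : m.toReal ≤ K * (1 + m.toReal) := by
    have := ENNReal.toReal_mono (ENNReal.mul_ne_top ENNReal.ofReal_ne_top (by simpa using hmtop)) hmle
    rwa [ENNReal.toReal_mul, ENNReal.toReal_ofReal hK0, ENNReal.toReal_add ENNReal.one_ne_top hmtop,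
      ENNReal.toReal_one] at this
  have hm0 : 0 ≤ m.toReal := ENNReal.toReal_nonneg
  have hfin : m.toReal ≤ x := by
    have h2 : m.toReal ≤ x ^ 2 * (1 + m.toReal) := hreal.trans (mul_le_mul_of_nonneg_right hKx (by linarith))
    have hq : 0 ≤ x * (-(x ^ 2 + x - 1)) := mul_nonneg hx0.le (by nlinarith)
    have hxsq : x ^ 2 ≤ x * (1 - x ^ 2) := by nlinarith
    have h3 : m.toReal * (1 - x ^ 2) ≤ x ^ 2 := by nlinarith
    have h1x : 0 < 1 - x ^ 2 := by nlinarith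
    exact le_of_mul_le_mul_right (h3.trans hxsq) h1x
  exact (ENNReal.le_ofReal_iff_toReal_le hmtop hx0.le).2 hfin

/-- **Discharge of `smoothingParameter_two_pow_neg_le`** (Micciancio–Regev 2007, Lemma 3.2, in the
ℓ² form of Regev 2009, Lemma 2.6): `η_{2⁻ⁿ}(L) ≤ √n/λ₁(L*)`. Every `s > √n/λ₁(L*)` belongs to the
defining set of `η_{2⁻ⁿ}(L)` (`gaussianMass_dual_le_two_pow_neg_of_lt`), so the infimum is at most
`√n/λ₁(L*)`; in the zero space both sides vanish. [cite: MicciancioRegev2007, Lemma 3.2] -/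
theorem smoothingParameter_two_pow_neg_le_holds : smoothingParameter_two_pow_neg_le L := by
  unfold smoothingParameter_two_pow_neg_le
  rcases subsingleton_or_nontrivial E with hE | hE
  · have h0 : finrank ℝ E = 0 := Module.finrank_zero_of_subsingleton
    rw [h0, pow_zero, Nat.cast_zero, Real.sqrt_zero, zero_div]
    have hS : {s : ℝ | 0 < s ∧ gaussianMass (1 / s) 0 ((dualLattice L : Set E) \ {0}) ≤ ENNReal.ofReal 1} =
        Set.Ioi 0 := by
      ext s
      simp only [Set.mem_setOf_eq, Set.mem_Ioi, dualLattice_sdiff_zero_eq_empty, gaussianMass_empty, zero_le,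
        and_true]
    rw [smoothingParameter, hS, csInf_Ioi]
  · refine le_of_forall_gt_imp_ge_of_dense fun s hs ↦ csInf_le (smoothingSet_bddBelow L _) ?_
    have hlam : 0 < minNorm (dualLattice L) := minNorm_pos_of_ne_bot _ (dualLattice_ne_bot L)
    have hsqrt : 0 ≤ Real.sqrt (finrank ℝ E) := Real.sqrt_nonneg _
    exact ⟨lt_of_le_of_lt (div_nonneg hsqrt hlam.le) hs, gaussianMass_dual_le_two_pow_neg_of_lt L hs⟩

open scoped Classical in
/-- The punctured dual mass as a real series over the dual lattice:
`ρ_{σ}(L* ∖ {0}) = ofReal (∑_{w ∈ L*} [w ≠ 0] ρ_σ(w))`. [cite: MicciancioRegev2007, Def. 3.1] -/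
theorem gaussianMass_dual_sdiff_zero_eq_ofReal_tsum_ite {σ : ℝ} (hσ : σ ≠ 0) :
    gaussianMass σ 0 ((dualLattice L : Set E) \ {0}) =
      ENNReal.ofReal (∑' w : dualLattice L, if w = 0 then 0 else gaussianFunction σ (w : E)) := by
  have hsplit := gaussianMass_eq_add_sdiff_zero (dualLattice L) σ 0
  have hF : gaussianMass σ 0 (dualLattice L : Set E) =
      ∑' w : dualLattice L, ENNReal.ofReal (gaussianFunction σ ((w : E) - 0)) := rfl
  rw [hF, ENNReal.tsum_eq_add_tsum_ite (0 : dualLattice L)] at hsplit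
  simp only [ZeroMemClass.coe_zero, sub_zero, gaussianFunction_zero, ENNReal.ofReal_one] at hsplit
  rw [ENNReal.add_right_inj ENNReal.one_ne_top] at hsplit
  have hnn : ∀ w : dualLattice L, 0 ≤ (if w = 0 then 0 else gaussianFunction σ (w : E)) := fun w ↦ by
    split_ifs
    · exact le_rfl
    · exact (gaussianFunction_pos _ _).le
  have hρS : Summable fun w : dualLattice L ↦ gaussianFunction σ (w : E) :=
    (summable_gaussianFunction_sub (dualLattice L) hσ (0 : E)).congr fun w ↦ by rw [sub_zero]
  have hsum : Summable fun w : dualLattice L ↦ if w = 0 then 0 else gaussianFunction σ (w : E) := by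
    refine Summable.of_nonneg_of_le hnn (fun w ↦ ?_) hρS
    split_ifs
    · exact (gaussianFunction_pos _ _).le
    · exact le_rfl
  rw [← hsplit, ENNReal.ofReal_tsum_of_nonneg hnn hsum]
  refine tsum_congr fun w ↦ ?_
  split_ifs <;> simp

/-- **Discharge of `abs_gaussianMass_div_sub_one_le`** (Regev 2009, Claim 3.8; the computation of
Micciancio–Regev 2007, Lemma 4.1 and Lemma 4.4 via Poisson summation): for a full-rank lattice `L`
in dimension `n`, `0 < ε`, `0 < s` with `η_ε(L) ≤ s`, and any centre `c`,
`|ρ_{s,c}(L) / (sⁿ / vol(L)) - 1| ≤ ε`. Indeed `ρ_{s,c}(L) vol(L) s⁻ⁿ = ∑_{w ∈ L*} ρ_{1/s}(w) cos(2π⟪c, w⟫)`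
(shifted Poisson identity), the term `w = 0` is `1`, and the rest is at most `ρ_{1/s}(L* ∖ {0}) ≤ ε`
in absolute value. [cite: Regev2009, Claim 3.8; MicciancioRegev2007 Lemma 4.4 (proof, p. 15)] -/
theorem abs_gaussianMass_div_sub_one_le_holds : abs_gaussianMass_div_sub_one_le L := by
  classical
  intro _ _ ε s hε hs hηs c
  set n : ℕ := finrank ℝ E with hn
  have hcov : 0 < ZLattice.covolume L := ZLattice.covolume_pos L volume
  have hQ : (gaussianMass s c (L : Set E)).toReal = ∑' y : L, gaussianFunction s ((y : E) - c) := by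
    rw [gaussianMass_coe_eq_ofReal_tsum L hs.ne' c,
      ENNReal.toReal_ofReal (tsum_nonneg fun _ ↦ (gaussianFunction_pos _ _).le)]
  rw [hQ, tsum_gaussianFunction_sub_eq L hs c]
  set P : ℝ := ∑' w : dualLattice L, gaussianFunction s⁻¹ (w : E) * Real.cos (2 * π * ⟪c, (w : E)⟫_ℝ) with hP
  have hquot : (ZLattice.covolume L)⁻¹ * s ^ n * P / (s ^ n / ZLattice.covolume L) = P := by
    field_simp
  rw [hquot]
  -- split off the term `w = 0`, which is `1`
  have hS : Summable fun w : dualLattice L ↦ gaussianFunction s⁻¹ (w : E) * Real.cos (2 * π * ⟪c, (w : E)⟫_ℝ) :=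
    summable_gaussianFunction_mul_cos _ (inv_ne_zero hs.ne') c
  have hsplit := hS.tsum_eq_add_tsum_ite (0 : dualLattice L)
  simp only [ZeroMemClass.coe_zero, gaussianFunction_zero, inner_zero_right, mul_zero, Real.cos_zero,
    mul_one] at hsplit
  rw [hP, hsplit, add_sub_cancel_left]
  -- the remainder is bounded by the punctured dual mass
  set g : dualLattice L → ℝ := fun w ↦ if w = 0 then 0 else gaussianFunction s⁻¹ (w : E) with hg
  have hnn : ∀ w, 0 ≤ g w := fun w ↦ by
    simp only [hg]
    split_ifs
    · exact le_rfl
    · exact (gaussianFunction_pos _ _).le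
  have hρS : Summable fun w : dualLattice L ↦ gaussianFunction s⁻¹ (w : E) :=
    (summable_gaussianFunction_sub (dualLattice L) (inv_ne_zero hs.ne') (0 : E)).congr fun w ↦ by rw [sub_zero]
  have hgS : Summable g := by
    refine Summable.of_nonneg_of_le hnn (fun w ↦ ?_) hρS
    simp only [hg]
    split_ifs
    · exact (gaussianFunction_pos _ _).le
    · exact le_rfl
  have hR : |∑' w : dualLattice L,
      (if w = 0 then 0 else gaussianFunction s⁻¹ (w : E) * Real.cos (2 * π * ⟪c, (w : E)⟫_ℝ))| ≤ ∑' w, g w := by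
    rw [← Real.norm_eq_abs]
    apply tsum_of_norm_bounded hgS.hasSum
    intro w
    simp only [hg]
    split_ifs
    · simp
    · rw [Real.norm_eq_abs, abs_mul, abs_of_pos (gaussianFunction_pos _ _)]
      exact mul_le_of_le_one_right (gaussianFunction_pos _ _).le (Real.abs_cos_le_one _)
  have hT : ∑' w, g w ≤ ε := by
    have h1 : gaussianMass s⁻¹ 0 ((dualLattice L : Set E) \ {0}) ≤ ENNReal.ofReal ε := by
      rw [← one_div]
      exact gaussianMass_dual_le_of_smoothingParameter_le L hε hηs
    rw [gaussianMass_dual_sdiff_zero_eq_ofReal_tsum_ite L (inv_ne_zero hs.ne')] at h1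
    exact (ENNReal.ofReal_le_ofReal_iff hε.le).1 h1
  exact hR.trans hT

end FullRank

end Literature.Algebra.EuclideanLattices

end
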